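import Summits.QuantumAdvantage.QuantumAdvantage.Theses.SosSandwich
import Summits.QuantumAdvantage.QuantumAdvantage.Theorems.SosSandwichQueryAcceptPseudoBounded
import Summits.QuantumAdvantage.QuantumAdvantage.Theorems.SosSandwichTransferPBSimTreePB
import Summits.QuantumAdvantage.QuantumAdvantage.Theorems.SosSandwichTransferPBQueryHalfPB
import Literature.Computability.QuantumComplexity.AaronsonAmbainis
import Literature.Computability.QuantumComplexity.PseudoBounded
import Literature.Computability.QuantumComplexity.DFKOInfluenceBound
import Literature.Computability.QuantumComplexity.DFKOInfluenceBoundProofs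
import Literature.Computability.Cryptography.QuantumQuery
import HarnessLib

/-!
# Route `SosSandwich`, crux `PseudoBoundedAA` (stmt-QuantumAdvantage-15237) — PB-AA already gives Aaronson–Ambainis' Conjecture 4; and the unconditional `2^{O(T)}` form

Consequence theorems (calibration of the crux, `--supports stmt-QuantumAdvantage-15237`).

§2 `quantumQuerySimulable_of_pseudoBoundedAA`: the route's crux `PseudoBoundedAA` (PB-AA: pseudo-bounded
polynomials of order `T` with variance `≥ ε` have a variable of influence `≥ C (ε/T)^c`) implies the Literature
conjecture `Literature.Computability.QuantumComplexity.QuantumQuerySimulable` (Aaronson–Ambainis 2014,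
Conjecture 1.5 = arXiv Conjecture 4: every `T`-query quantum algorithm is `ε`-approximated on all but a `δ`
fraction of the inputs by a deterministic decision tree of depth `poly(T, 1/ε, 1/δ)`).  The tree's Theorem 7 (i)
(`AaronsonAmbainis2014_thm7_holds : AAConjecture → QuantumQuerySimulable`) takes the full Aaronson–Ambainis
conjecture; PB-AA is WEAKER (`Theses.SosSandwich.AAConjImpliesPBAA`, proved; `K_T ⊊ {bounded, deg ≤ 2T}`), yet
suffices, because the simulation (Aaronson–Ambainis Thm. 21) only ever asks for influential variables of
RESTRICTIONS of the acceptance polynomial, which stay in the SOS sandwich class `K_T` — the observation the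
route's `TransferPB` is built on, here in the query model.  Constants: `C' = (⌈16·4^c/C⌉ + 1)·2^{4c+2}`,
`k = 4c + 2` from PB-AA's `(c, C)`.

§3 `quantumQuerySimulable_exp` (UNCONDITIONAL): with the tree's proved Dinur–Friedgut–Kindler–O'Donnell bound
(`dfko2007_influence_bounded_holds`: `Inf ≥ ε³/2^{21 d}` for bounded degree-`d` polynomials) in place of PB-AA,
the same simulation gives depth `≤ 2^{90(T+1)} · (T/(εδ) + 1)^{14}` — Conjecture 4 with an EXPONENTIAL dependence
on the number `T` of quantum queries but none on `N` (the known unconditional state of affairs,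
Aaronson–Ambainis 2014 p. 6 / Thm. 9): quantum algorithms with `O(1)` queries are simulable on most inputs by
`O(1)` classical queries.

Assembly of landed pieces: `Theorems.SosSandwich.QueryAcceptPseudoBounded_proof` (`Q_T ⊆ K_T`, Beals et al.)
⟹ `exists_pseudoBounded_acceptPoly` (an explicit `p ∈ K_T` of total degree `≤ 2T` with
`evalBool p = Q.acceptProb`); `Cruxes.TransferPB.Birth.SimTreePB.simTree_depth_error_le_pb` /
`simTree_depth_error_le_of_inv` (and `pbInfluenceBound_of_pseudoBoundedAA`, PB-AA in tree vocabulary) (Thm. 21 on a restriction-closed class, explicit depth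
`(⌈16·4^c/C⌉+1)(d/(εδ)+1)^{4c+2}`) at `d = 2T`; the arithmetic `2T/(εδ) + 1 ≤ 2 (T/(εδ) + 1)`; the `T = 0`
case (a `0`-query algorithm has a constant acceptance probability: one leaf).
Honest label: consequences of the crux / of DFKO (motivation and calibration), not steps toward proving PB-AA.

Sources: AaronsonAmbainis2014 (ToC 10) Conj. 1.5, Thm. 1.8 (i) = Thm. 3.3, p. 6 / arXiv:0911.0996v3 Thm. 21;
BealsEtAl2001 Lemma 4.1; KaniewskiLeeDewolf2015 Thm. 12; DinurEtAl2007 Thm. 3.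
-/

-- D-0017: single-conjunct summit ⇒ the duplicate `QuantumAdvantage.QuantumAdvantage` is mandated.
set_option linter.dupNamespace false

noncomputable section

namespace Summit.QuantumAdvantage.QuantumAdvantage.Theorems.SosSandwich

open Finset MvPolynomial
open Literature.Computability.Cryptography (QQueryAlg)
open Literature.Computability.QuantumComplexity
open Literature.Computability.QuantumComplexity.ClassicalSimulation
open Summit.QuantumAdvantage.QuantumAdvantage.Theses.SosSandwich (PseudoBoundedAA QueryAcceptPseudoBounded)
open Summit.QuantumAdvantage.QuantumAdvantage.Cruxes.TransferPB.Birth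

namespace PBAAQuerySimulable

variable {N : ℕ}

/-! ### §1 The acceptance polynomial of a query algorithm, as a member of `K_T` -/

/-- **`Q_T ⊆ K_T` with an explicit polynomial.** For every `T`-query quantum algorithm `Q` on `N` bits there
is a real polynomial `p = Σ_j q_j²` of total degree `≤ 2T`, pseudo-bounded of order `T`, whose cube values
are `Q`'s acceptance probabilities (`QueryAcceptPseudoBounded_proof`: Beals et al. amplitude polynomials plus
unitarity). [cite: BealsEtAl2001, Lemma 4.1] -/
theorem exists_pseudoBounded_acceptPoly (Q : QQueryAlg N) :
    ∃ p : MvPolynomial (Fin N) ℝ, PseudoBounded Q.queries p ∧ p.totalDegree ≤ 2 * Q.queries ∧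
      ∀ x : Fin N → Bool, evalBool p x = Q.acceptProb x := by
  obtain ⟨m, q, r, hdeg, hval⟩ := QueryAcceptPseudoBounded_proof N Q
  have hsum : ∀ x : Fin N → Bool,
      MvPolynomial.eval (fun k => if x k then (1 : ℝ) else 0) (∑ j, q j ^ 2) =
        ∑ j, MvPolynomial.eval (fun k => if x k then (1 : ℝ) else 0) (q j) ^ 2 := fun x => by
    rw [map_sum]
    exact Finset.sum_congr rfl fun j _ => map_pow _ _ _
  refine ⟨∑ j, q j ^ 2, ⟨m, q, r, hdeg, fun x => ⟨hsum x, ?_⟩⟩, ?_, fun x => ?_⟩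
  · rw [hsum x, ← (hval x).1]
    exact (hval x).2
  · refine totalDegree_finsetSum_le fun j _ => ?_
    calc (q j ^ 2).totalDegree ≤ 2 * (q j).totalDegree := totalDegree_pow _ _
      _ ≤ 2 * Q.queries := Nat.mul_le_mul_left 2 (hdeg j).1
  · rw [(hval x).1]
    exact hsum x

/-- A `0`-query algorithm has a constant acceptance probability (its acceptance polynomial has total degree
`0`). [cite: BealsEtAl2001, Lemma 4.1] -/
theorem acceptProb_const_of_queries_eq_zero (Q : QQueryAlg N) (hQ : Q.queries = 0) (x y : Fin N → Bool) :
    Q.acceptProb x = Q.acceptProb y := by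
  obtain ⟨p, -, hdeg, hval⟩ := exists_pseudoBounded_acceptPoly Q
  have h0 : p.totalDegree = 0 := by
    have : p.totalDegree ≤ 0 := by simpa [hQ] using hdeg
    exact Nat.le_zero.mp this
  have hp := totalDegree_eq_zero_iff_eq_C.mp h0
  rw [← hval x, ← hval y]
  unfold evalBool
  rw [hp, eval_C, eval_C]

/-! ### §2 Conjecture 4 from PB-AA -/

/-- Arithmetic of the depth bound: `(2T/(εδ) + 1)^k ≤ 2^k (T/(εδ) + 1)^k`. [folklore] -/
theorem depth_arith (T : ℕ) {ε δ : ℝ} (hε : 0 < ε) (hδ : 0 < δ) (k : ℕ) :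
    (((2 * T : ℕ) : ℝ) / (ε * δ) + 1) ^ k ≤ (2 : ℝ) ^ k * ((T : ℝ) / (ε * δ) + 1) ^ k := by
  rw [← mul_pow]
  apply pow_le_pow_left₀ (by positivity)
  have hT : 0 ≤ (T : ℝ) / (ε * δ) := by positivity
  push_cast
  rw [mul_div_assoc]
  linarith

/-- The `T = 0` case of the simulation: a single leaf is exactly right everywhere. [folklore] -/
theorem leaf_simulates_of_queries_eq_zero (Q : QQueryAlg N) (hQ : Q.queries = 0) {ε : ℝ} (hε : 0 < ε) :
    (univ.filter fun x : Fin N → Bool =>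
        ε < |(RealDecisionTree.leaf (Q.acceptProb fun _ => false) : RealDecisionTree N).eval x -
          Q.acceptProb x|) = ∅ := by
  refine Finset.filter_eq_empty_iff.mpr fun x _ => ?_
  rw [RealDecisionTree.eval_leaf, acceptProb_const_of_queries_eq_zero Q hQ (fun _ => false) x, sub_self,
    abs_zero]
  exact not_lt.mpr hε.le

/-- **The simulation at order `d = 2T` on the SOS sandwich class, for a `T ≥ 1`-query algorithm**, granted an
influence bound `C₀ (ε'/(2T))^c` on `K_{2T}` in `N` variables: a decision tree of depth
`≤ (⌈16·4^c/C₀⌉+1)·2^{4c+2}·(T/(εδ)+1)^{4c+2}` that is `ε`-accurate on all but `≤ δ 2^N` inputs.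
[cite: AaronsonAmbainis2014, Thm. 21 (proof, pp. 13–14)] -/
theorem exists_tree_of_influenceBound (Q : QQueryAlg N) (hT : 1 ≤ Q.queries) {c : ℕ} {C₀ : ℝ} (hC₀ : 0 < C₀)
    (H : ∀ (q : MvPolynomial (Fin N) ℝ) (ε' : ℝ), PseudoBounded (2 * Q.queries) q → 0 < ε' →
        ε' ≤ boolVariance q → ∃ i : Fin N, C₀ * (ε' / (2 * Q.queries : ℕ)) ^ c ≤ influence i q)
    {ε δ : ℝ} (hε : 0 < ε) (hε1 : ε ≤ 1) (hδ : 0 < δ) (hδ1 : δ ≤ 1) :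
    ∃ t : RealDecisionTree N,
      (t.depth : ℝ) ≤ (((Nat.ceil (16 * 2 ^ c * 2 ^ c / C₀) + 1) * 2 ^ (4 * c + 2) : ℕ) : ℝ) *
          ((Q.queries : ℝ) / (ε * δ) + 1) ^ (4 * c + 2) ∧
        ((univ.filter fun x : Fin N → Bool => ε < |t.eval x - Q.acceptProb x|).card : ℝ) ≤ δ * 2 ^ N := by
  obtain ⟨p, hpb, hdeg, hval⟩ := exists_pseudoBounded_acceptPoly Q
  have hd1 : 1 ≤ 2 * Q.queries := by omega
  have hTd : Q.queries ≤ 2 * Q.queries := by omega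
  obtain ⟨hdepth, herr⟩ :=
    SimTreePB.simTree_depth_error_le_pb (c := c) hC₀ hd1 hTd H hpb hdeg hε hε1 hδ hδ1
  refine ⟨_, hdepth.trans ?_, ?_⟩
  · have hA : (0 : ℝ) ≤ (Nat.ceil (16 * 2 ^ c * 2 ^ c / C₀) + 1 : ℕ) := by positivity
    calc ((Nat.ceil (16 * 2 ^ c * 2 ^ c / C₀) + 1 : ℕ) : ℝ) *
          (((2 * Q.queries : ℕ) : ℝ) / (ε * δ) + 1) ^ (4 * c + 2)
        ≤ ((Nat.ceil (16 * 2 ^ c * 2 ^ c / C₀) + 1 : ℕ) : ℝ) *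
            ((2 : ℝ) ^ (4 * c + 2) * ((Q.queries : ℝ) / (ε * δ) + 1) ^ (4 * c + 2)) :=
          mul_le_mul_of_nonneg_left (depth_arith Q.queries hε hδ (4 * c + 2)) hA
      _ = (((Nat.ceil (16 * 2 ^ c * 2 ^ c / C₀) + 1) * 2 ^ (4 * c + 2) : ℕ) : ℝ) *
            ((Q.queries : ℝ) / (ε * δ) + 1) ^ (4 * c + 2) := by
          push_cast
          ring
  · refine le_trans (le_of_eq ?_) herr
    congr 1
    refine congrArg Finset.card (Finset.filter_congr fun x _ => ?_)
    rw [hval x]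

end PBAAQuerySimulable

open PBAAQuerySimulable in
/-- **PB-AA implies Aaronson–Ambainis' Conjecture 4 (classical simulation of quantum query algorithms on most
inputs).** Granted the route's crux `PseudoBoundedAA` with constants `(c, C)`, every `T`-query quantum algorithm
on `N` bits is `ε`-approximated on all but `δ·2^N` inputs by a deterministic decision tree of depth
`≤ (⌈16·4^c/C⌉ + 1)·2^{4c+2}·(T/(εδ) + 1)^{4c+2}` — the Literature statement `QuantumQuerySimulable` with
`C' = (⌈16·4^c/C⌉+1)·2^{4c+2}`, `k = 4c+2`.  Proof: the acceptance polynomial `p = Σ q_j² ∈ K_T` has degree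
`≤ 2T` (`exists_pseudoBounded_acceptPoly`); run Aaronson–Ambainis' simulation tree at order `d = 2T`, whose
analysis needs influential variables only of restrictions of `p`, all in `K_{2T}`
(`SimTreePB.simTree_depth_error_le_pb`); a `0`-query algorithm is a single leaf.  This strengthens the tree's
`AaronsonAmbainis2014_thm7_holds` (hypothesis `AAConjecture`) to the weaker hypothesis PB-AA
(`AAConjImpliesPBAA`). [cite: AaronsonAmbainis2014, Thm. 21 and Thm. 7 (i)] -/
theorem quantumQuerySimulable_of_pseudoBoundedAA (h : PseudoBoundedAA) : QuantumQuerySimulable := by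
  obtain ⟨c, C₀, hC₀, HPB⟩ := SimTreePB.pbInfluenceBound_of_pseudoBoundedAA h
  refine ⟨(Nat.ceil (16 * 2 ^ c * 2 ^ c / C₀) + 1) * 2 ^ (4 * c + 2), 4 * c + 2, ?_⟩
  intro N Q ε δ hε hε1 hδ hδ1
  rcases Nat.eq_zero_or_pos Q.queries with hT0 | hTpos
  · refine ⟨RealDecisionTree.leaf (Q.acceptProb fun _ => false), ?_, ?_⟩
    · simp only [RealDecisionTree.depth_leaf, Nat.cast_zero]
      positivity
    · rw [leaf_simulates_of_queries_eq_zero Q hT0 hε, Finset.card_empty, Nat.cast_zero]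
      positivity
  · exact exists_tree_of_influenceBound Q hTpos hC₀
      (fun q ε' hq hε' hv => HPB N (2 * Q.queries) q ε' (by omega) hq hε' hv) hε hε1 hδ hδ1

/-! ### §3 The unconditional `2^{O(T)}` form, from DFKO -/

namespace PBAAQuerySimulable

variable {N : ℕ}

/-- DFKO's bound in the shape the simulation consumes: at a FIXED order `d ≥ 1`, with the `d`-dependent constant
`C_d = d^a / 2^{C d}`, `C_d (ε/d)^a = ε^a / 2^{C d}`. [cite: DinurEtAl2007, Thm. 3] -/
theorem dfko_shape {a C : ℕ}
    (H : ∀ (N d : ℕ) (p : MvPolynomial (Fin N) ℝ) (ε : ℝ), 1 ≤ d → p.totalDegree ≤ d →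
      (∀ x, 0 ≤ evalBool p x ∧ evalBool p x ≤ 1) → 0 < ε → ε ≤ boolVariance p →
        ∃ i : Fin N, ε ^ a / (2 : ℝ) ^ (C * d) ≤ influence i p)
    {N d : ℕ} (hd : 1 ≤ d) (q : MvPolynomial (Fin N) ℝ) (ε : ℝ) (hdeg : q.totalDegree ≤ d)
    (hbd : ∀ x, 0 ≤ evalBool q x ∧ evalBool q x ≤ 1) (hε : 0 < ε) (hv : ε ≤ boolVariance q) :
    ∃ i : Fin N, ((d : ℝ) ^ a / (2 : ℝ) ^ (C * d)) * (ε / d) ^ a ≤ influence i q := by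
  obtain ⟨i, hi⟩ := H N d q ε hd hdeg hbd hε hv
  refine ⟨i, le_of_eq_of_le ?_ hi⟩
  have hd0 : (d : ℝ) ^ a ≠ 0 := by positivity
  rw [div_pow]
  field_simp

/-- Arithmetic: `⌈16·4^a / (d^a/2^{Cd})⌉ + 1 ≤ 2^{5 + 2a + C d}` for `d ≥ 1` (crudely, `d^a ≥ 1`). [folklore] -/
theorem ceil_const_le (a C d : ℕ) (hd : 1 ≤ d) :
    ((Nat.ceil (16 * 2 ^ a * 2 ^ a / ((d : ℝ) ^ a / (2 : ℝ) ^ (C * d))) + 1 : ℕ) : ℝ) ≤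
      (2 : ℝ) ^ (5 + 2 * a + C * d) := by
  have hd1 : (1 : ℝ) ≤ (d : ℝ) ^ a := one_le_pow₀ (by exact_mod_cast hd)
  have hda : (0 : ℝ) < (d : ℝ) ^ a := by positivity
  have h2 : (2 : ℝ) ^ (4 + 2 * a + C * d) = 16 * 2 ^ a * 2 ^ a * 2 ^ (C * d) := by
    ring
  have h16 : (16 : ℝ) ≤ (2 : ℝ) ^ (4 + 2 * a + C * d) :=
    calc (16 : ℝ) = 2 ^ 4 := by norm_num
      _ ≤ (2 : ℝ) ^ (4 + 2 * a + C * d) := pow_le_pow_right₀ (by norm_num) (by omega)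
  have hX : 16 * 2 ^ a * 2 ^ a / ((d : ℝ) ^ a / (2 : ℝ) ^ (C * d)) ≤ (2 : ℝ) ^ (4 + 2 * a + C * d) := by
    rw [div_div_eq_mul_div, div_le_iff₀ hda, h2]
    exact le_mul_of_one_le_right (by positivity) hd1
  have hceil : ((Nat.ceil (16 * 2 ^ a * 2 ^ a / ((d : ℝ) ^ a / (2 : ℝ) ^ (C * d))) : ℕ) : ℝ) <
      16 * 2 ^ a * 2 ^ a / ((d : ℝ) ^ a / (2 : ℝ) ^ (C * d)) + 1 := Nat.ceil_lt_add_one (by positivity)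
  have hpow : (2 : ℝ) ^ (5 + 2 * a + C * d) = 2 * (2 : ℝ) ^ (4 + 2 * a + C * d) := by
    rw [show 5 + 2 * a + C * d = (4 + 2 * a + C * d) + 1 by ring, pow_succ]
    ring
  have h1 : (1 : ℝ) ≤ (2 : ℝ) ^ (4 + 2 * a + C * d) := one_le_pow₀ (by norm_num)
  push_cast
  linarith

/-- **The simulation at order `d = 2T` for a `T ≥ 1`-query algorithm under a DFKO-type bound** `ε^a/2^{Cd}`
for bounded degree-`d` polynomials: a decision tree of depth `≤ 2^{(7+6a+2C)(T+1)}·(T/(εδ)+1)^{4a+2}`,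
`ε`-accurate on all but `≤ δ 2^N` inputs (Thm. 21 with the trivial invariant class and the `d`-dependent
constant `C_d = d^a/2^{Cd}`). [cite: AaronsonAmbainis2014, Thm. 21 (proof, pp. 13–14)] -/
theorem exists_tree_of_dfkoBound (Q : QQueryAlg N) (hT : 1 ≤ Q.queries) {a C : ℕ}
    (H : ∀ (N d : ℕ) (p : MvPolynomial (Fin N) ℝ) (ε : ℝ), 1 ≤ d → p.totalDegree ≤ d →
      (∀ x, 0 ≤ evalBool p x ∧ evalBool p x ≤ 1) → 0 < ε → ε ≤ boolVariance p →
        ∃ i : Fin N, ε ^ a / (2 : ℝ) ^ (C * d) ≤ influence i p)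
    {ε δ : ℝ} (hε : 0 < ε) (hε1 : ε ≤ 1) (hδ : 0 < δ) (hδ1 : δ ≤ 1) :
    ∃ t : RealDecisionTree N,
      (t.depth : ℝ) ≤ (2 : ℝ) ^ ((7 + 6 * a + 2 * C) * (Q.queries + 1)) *
          ((Q.queries : ℝ) / (ε * δ) + 1) ^ (4 * a + 2) ∧
        ((univ.filter fun x : Fin N → Bool => ε < |t.eval x - Q.acceptProb x|).card : ℝ) ≤ δ * 2 ^ N := by
  obtain ⟨p, hpb, hdeg, hval⟩ := exists_pseudoBounded_acceptPoly Q
  set d : ℕ := 2 * Q.queries with hd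
  have hd1 : 1 ≤ d := by omega
  have hTd : Q.queries ≤ d := by omega
  have hCd : (0 : ℝ) < (d : ℝ) ^ a / (2 : ℝ) ^ (C * d) := by positivity
  have hbd : ∀ x, 0 ≤ evalBool p x ∧ evalBool p x ≤ 1 := (hpb.mono hTd).bounded
  have H' : ∀ (q : MvPolynomial (Fin N) ℝ) (ε' : ℝ), (fun _ : MvPolynomial (Fin N) ℝ => True) q →
      q.totalDegree ≤ d → (∀ x, 0 ≤ evalBool q x ∧ evalBool q x ≤ 1) → 0 < ε' → ε' ≤ boolVariance q →
        ∃ i : Fin N, ((d : ℝ) ^ a / (2 : ℝ) ^ (C * d)) * (ε' / d) ^ a ≤ influence i q :=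
    fun q ε' _ hq hb hε' hv => dfko_shape H hd1 q ε' hq hb hε' hv
  obtain ⟨hdepth, herr⟩ := SimTreePB.simTree_depth_error_le_of_inv (c := a) hCd hd1
    (K := fun _ : MvPolynomial (Fin N) ℝ => True) (fun _ _ _ _ => trivial) H' trivial hdeg hbd hε hε1 hδ hδ1
  refine ⟨_, hdepth.trans ?_, ?_⟩
  · have hA := ceil_const_le a C d hd1
    have hB := depth_arith Q.queries hε hδ (4 * a + 2)
    have hX : (0 : ℝ) ≤ ((Q.queries : ℝ) / (ε * δ) + 1) ^ (4 * a + 2) := by positivity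
    have hexp : 5 + 2 * a + C * d + (4 * a + 2) ≤ (7 + 6 * a + 2 * C) * (Q.queries + 1) := by
      rw [hd]; nlinarith
    have hpow : (2 : ℝ) ^ (5 + 2 * a + C * d) * (2 : ℝ) ^ (4 * a + 2) ≤
        (2 : ℝ) ^ ((7 + 6 * a + 2 * C) * (Q.queries + 1)) := by
      rw [← pow_add]
      exact pow_le_pow_right₀ (by norm_num) hexp
    calc ((Nat.ceil (16 * 2 ^ a * 2 ^ a / ((d : ℝ) ^ a / (2 : ℝ) ^ (C * d))) + 1 : ℕ) : ℝ) *
          (((d : ℕ) : ℝ) / (ε * δ) + 1) ^ (4 * a + 2)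
        ≤ (2 : ℝ) ^ (5 + 2 * a + C * d) * ((2 : ℝ) ^ (4 * a + 2) *
            ((Q.queries : ℝ) / (ε * δ) + 1) ^ (4 * a + 2)) :=
          mul_le_mul hA (by rw [hd]; exact hB) (by positivity) (by positivity)
      _ = ((2 : ℝ) ^ (5 + 2 * a + C * d) * (2 : ℝ) ^ (4 * a + 2)) *
            ((Q.queries : ℝ) / (ε * δ) + 1) ^ (4 * a + 2) := by ring
      _ ≤ (2 : ℝ) ^ ((7 + 6 * a + 2 * C) * (Q.queries + 1)) *
            ((Q.queries : ℝ) / (ε * δ) + 1) ^ (4 * a + 2) := mul_le_mul_of_nonneg_right hpow hX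
  · refine le_trans (le_of_eq ?_) herr
    congr 1
    refine congrArg Finset.card (Finset.filter_congr fun x _ => ?_)
    rw [hval x]

end PBAAQuerySimulable

open PBAAQuerySimulable in
/-- **Unconditional: every `T`-query quantum algorithm is simulable on most inputs by `2^{O(T)}·poly(1/(εδ))`
classical queries, independently of `N`.** With the tree's PROVED Dinur–Friedgut–Kindler–O'Donnell bound
(`dfko2007_influence_bounded_holds`: `Inf ≥ ε^a/2^{C d}` for bounded degree-`d` polynomials) in place of
PB-AA, the simulation of §2 gives constants `b, k` such that every `T`-query algorithm on `N` bits and all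
`ε, δ ∈ (0,1]` admit a decision tree of depth `≤ 2^{b (T+1)} · (T/(εδ) + 1)^k` that is `ε`-accurate on all but
`≤ δ 2^N` inputs — Aaronson–Ambainis' Conjecture 4 with an exponential (instead of polynomial) dependence on `T`
and NO dependence on `N` (the unconditional state of the art recorded on p. 6 of the source: "[DFKO] implies
our conjecture, except with `Inf ≥ ε⁵/2^{O(d)}`"); with the tree's DFKO constants `(a, C) = (3, 21)` one gets
`b = 67`, `k = 14`.  In particular quantum algorithms making `O(1)` queries are `ε`-approximated on a `1 − δ`
fraction of inputs by `O_{ε,δ}(1)` classical queries. [cite: AaronsonAmbainis2014, Thm. 21 and p. 6]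
[cite: DinurEtAl2007, Thm. 3] -/
theorem quantumQuerySimulable_exp :
    ∃ (b k : ℕ), ∀ (N : ℕ) (Q : QQueryAlg N) (ε δ : ℝ), 0 < ε → ε ≤ 1 → 0 < δ → δ ≤ 1 →
      ∃ t : RealDecisionTree N,
        (t.depth : ℝ) ≤ (2 : ℝ) ^ (b * (Q.queries + 1)) * ((Q.queries : ℝ) / (ε * δ) + 1) ^ k ∧
        ((Finset.univ.filter fun x : Fin N → Bool => ε < |t.eval x - Q.acceptProb x|).card : ℝ)
          ≤ δ * (2 : ℝ) ^ N := by
  obtain ⟨a, C, HD⟩ := dfko2007_influence_bounded_holds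
  refine ⟨7 + 6 * a + 2 * C, 4 * a + 2, fun N Q ε δ hε hε1 hδ hδ1 => ?_⟩
  rcases Nat.eq_zero_or_pos Q.queries with hT0 | hTpos
  · refine ⟨RealDecisionTree.leaf (Q.acceptProb fun _ => false), ?_, ?_⟩
    · simp only [RealDecisionTree.depth_leaf, Nat.cast_zero]
      positivity
    · rw [leaf_simulates_of_queries_eq_zero Q hT0 hε, Finset.card_empty, Nat.cast_zero]
      positivity
  · exact exists_tree_of_dfkoBound Q hTpos HD hε hε1 hδ hδ1

/-! ### §4 The quantum-only influence conjecture `AA_Q` in the lattice: `AAConj ⟹ AA_Q`, `PB-AA ⟹ AA_Q` -/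

/-- **PB-AA implies the influence bound for quantum acceptance probabilities (`AA_Q`)**, with the same
constants: a polynomial with the cube values of a `T`-query algorithm is pseudo-bounded of order `T`
(`exists_pseudoBounded_acceptPoly` + `PseudoBounded.of_eval_eq`).  `AA_Q` (inline) is the minimal hypothesis
of the Aaronson–Ambainis simulation (`Theorems/SosSandwichQueryRestrict.lean`: `quantumQuerySimulable_of_aaQuery`).
[cite: AaronsonAmbainis2014, Conj. 6 and Thm. 7 (i)] -/
theorem aaQuery_of_pseudoBoundedAA (h : PseudoBoundedAA) :
    ∃ (c : ℕ) (C : ℝ), 0 < C ∧ ∀ (N : ℕ) (Q : QQueryAlg N) (p : MvPolynomial (Fin N) ℝ) (ε : ℝ),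
      1 ≤ Q.queries → (∀ x, evalBool p x = Q.acceptProb x) → 0 < ε → ε ≤ boolVariance p →
        ∃ i : Fin N, C * (ε / Q.queries) ^ c ≤ influence i p := by
  obtain ⟨c, C₀, hC₀, H⟩ := SimTreePB.pbInfluenceBound_of_pseudoBoundedAA h
  refine ⟨c, C₀, hC₀, fun N Q p ε hT hp hε hv => ?_⟩
  obtain ⟨p₀, hpb, -, hval⟩ := PBAAQuerySimulable.exists_pseudoBounded_acceptPoly Q
  have hpK : PseudoBounded Q.queries p :=
    hpb.of_eval_eq fun x => by
      change evalBool p x = evalBool p₀ x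
      rw [hp x, hval x]
  exact H N Q.queries p ε hT hpK hε hv

/-- **The Aaronson–Ambainis conjecture implies `AA_Q`** (constants `(c, C/2^c)`): the acceptance polynomial
`Σ q_j²` has degree `≤ 2T` and values in `[0,1]`, and variance/influences depend only on cube values.
[cite: AaronsonAmbainis2014, Conj. 6] -/
theorem aaQuery_of_aaConjecture (h : AAConjecture) :
    ∃ (c : ℕ) (C : ℝ), 0 < C ∧ ∀ (N : ℕ) (Q : QQueryAlg N) (p : MvPolynomial (Fin N) ℝ) (ε : ℝ),
      1 ≤ Q.queries → (∀ x, evalBool p x = Q.acceptProb x) → 0 < ε → ε ≤ boolVariance p →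
        ∃ i : Fin N, C * (ε / Q.queries) ^ c ≤ influence i p := by
  obtain ⟨c, C, hC, H⟩ := h
  refine ⟨c, C / 2 ^ c, by positivity, fun N Q p ε hT hp hε hv => ?_⟩
  obtain ⟨p₀, hpb, hdeg, hval⟩ := PBAAQuerySimulable.exists_pseudoBounded_acceptPoly Q
  have heq : evalBool p = evalBool p₀ := funext fun x => by rw [hp x, hval x]
  have hv0 : ε ≤ boolVariance p₀ := by
    have : boolVariance p = boolVariance p₀ := by unfold boolVariance; rw [heq]
    rw [← this]; exact hv
  have hd1 : 1 ≤ 2 * Q.queries := by omega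
  obtain ⟨i, hi⟩ := H N (2 * Q.queries) p₀ ε hd1 hdeg hpb.bounded hε hv0
  refine ⟨i, ?_⟩
  have hinf : influence i p = influence i p₀ := by unfold influence; rw [heq]
  rw [hinf]
  refine le_trans (le_of_eq ?_) hi
  have hT0 : (Q.queries : ℝ) ≠ 0 := by exact_mod_cast (by omega : Q.queries ≠ 0)
  push_cast
  rw [div_pow, div_pow, mul_pow]
  field_simp

end Summit.QuantumAdvantage.QuantumAdvantage.Theorems.SosSandwich

end
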